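import Literature.MathematicalPhysics.PowerSystems.OscillatorNetworkTypeCounts
import Literature.Probability.MarkovChains.DirichletPrinciple
import HarnessLib

/-!
# Zelazo–Bürger's theorem: a network with ONE line loaded beyond `π/2` (any topology) is stable
# iff `a · R⁺_eff(u ↔ v) ≤ 1` — the negative conductance of the long line against the effective
# resistance of the rest of the network between its ends; strictly stable iff `< 1`; a TYPE-1
# saddle iff `> 1` (first-order and swing models)

Topic `Literature/MathematicalPhysics/PowerSystems`; namespaces `…PowerSystems.SignedLaplacian`
(§1–§2), `…NonuniformKuramoto` (§3), `…ClassicalModel.LosslessSystem` (§4). Everything is PROVED: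
0 definitions, 0 named facts, 0 `sorry`. The effective resistance is the tree's
`Literature.Probability.MarkovChains.effectiveResistance c a z` (Levin–Peres §9.4, networks
`IsConductance c` with `IsIrreducible (networkKernel c)`), and the proofs run on the tree's
DIRICHLET PRINCIPLE `LyonsPeres2016_ex_2_13` / `_eq` (`1/R(a ↔ z) = min{E(F) : F(a)=1, F(z)=0}`,
attained at the unit voltage) and `eq_of_flowEnergy_currentFlow_eq_zero`; the TYPE statements use
`RefNode.refMinor_counts` and the tree's root-count theorems. `RingLongLineResistanceCriterion.lean`
is the cycle special case with the explicit series resistance `Σ 1/bₖ`.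

SOURCE (held, read on the page: `lit read paper:doi-10-1016-j-ifacol-2016-10-379`, p0002,
p0005–p0008). W. Chen, D. Wang, J. Liu, T. Başar, K. H. Johansson, L. Qiu, IFAC-PapersOnLine 49-22
(2016) 97–102 [ChenWangLiuBasarJohanssonQiu2016]. §1 (p0002 L11): «Zelazo and Bürger (2014),
signed Laplacians with only one negative weight … positive semidefinite if, and only if, the
effective resistance over the negatively weighted edge is nonnegative.» §3 (p0005): effective
resistance `r_eff(i,j) = u_ijᵀ L† u_ij` (unit current injected at `i`, extracted at `j`). §4
**Corollary 2** (p0007 L1–L3): «If G does not have any cycle containing two negatively weighted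
edges, then L is positive semidefinite and of corank(L) = 1 if, and only if, G is connected, and
r⁺_eff(i,j) < 1/|a_ij| for all (i,j) ∈ E₋», `r⁺_eff` over the subgraph `G₊`. §5 (p0008): droop /
first-order microgrid model, `J(θ₀) = −K⁻¹DW(θ₀)Dᵀ`, «critical lines across which the angle
differences are greater than π/2 … J(θ₀) has exactly the same number of positive, negative, and zero
eigenvalues as −L(θ₀) … θ₀ is small-disturbance stable if, and only if, L(θ₀) is positive
semidefinite and has a simple zero eigenvalue.» (D. Zelazo, M. Bürger, 53rd IEEE CDC (2014), Thm
III.3: cited through the above, not held.) Dirichlet principle: [LevinPeres2017] §9.4 Thm 9.10;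
[LyonsPeres2016] Exercise 2.13.

RENDERING (one negative edge). `c : Matrix X X ℝ` a connected non-negative network (the SHORT
lines), `u ≠ v`, and an extra edge `(u, v)` of weight `−a`; the signed form is
`Q(F) = ½ΣΣ c(x,y)(F(x) − F(y))² − a(F(u) − F(v))²`. In the models `c = c⁺` is the cosine-weight
matrix `Pᵢⱼcos(θᵢ − θⱼ)` with the diagonal and the pair `{u,v}` zeroed (a defining hypothesis `hcp`)
and `a = −P_{uv}cos(θ_u − θ_v)`; `IsConductance c⁺` says every other line is short (`cos ≥ 0`) and
every node carries a short line, `IsIrreducible` that `G⁺` is connected — the printed hypotheses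
«G connected, no cycle with two negative edges» in the one-negative-edge case (if the long line is a
bridge, `CutsetStabilityCriterion` / `KuramotoCutsetStabilityNecessity` already give instability).

WHAT IS PROVED.
* §1 `sq_sub_le_resistance_mul_dirichlet` (`(F(u) − F(v))² ≤ R · E(F)`), ★★★ **`form_nonneg_iff`**
  (`Q ≥ 0 ⟺ a·R ≤ 1`), ★★ `const_of_form_eq_zero` (`a·R < 1 ⇒ ker Q = ℝ𝟙`),
  `exists_form_neg_of_one_lt` (`a·R > 1 ⇒ Q(W₁) < 0` at the unit voltage),
  `exists_nonconst_form_eq_zero_of_eq_one` (`a·R = 1 ⇒ W₁` is a non-constant kernel vector),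
  ★★ **`inertia_of_one_lt`** (`a·R > 1 ⇒ (n₋, n₀, n₊)(H) = (1, 1, |X| − 2)` for any symmetric `H`
  with form `Q`).
* §2 `linForm_eq_posPart_add`: `Σᵢxᵢ Σⱼ Wᵢⱼ(xᵢ − xⱼ) = ½ΣΣ c⁺(xᵢ − xⱼ)² + W_{uv}(x_u − x_v)²`.
* §3 FIRST-ORDER network (`Kur : NonuniformKuramoto n`, lossless, ANY topology, ANY `ω`, ANY
  `Dᵢ > 0`): ★★★ **`longLine_stabilityMatrix_negSemidef_iff`** (`−L(θ)` NSD ⟺ `a·R⁺ ≤ 1`),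
  ★★ **`longLine_stabilityMatrix_negDef_iff`** (ND off the rotation ⟺ `a·R⁺ < 1`),
  ★★ `longLine_criterion_of_lockedSolution_stable` (Lyapunov-stable ⇒ `a·R⁺ ≤ 1`),
  ★★ `longLine_lockedSolution_locally_expStable_of_lt_one` / `…_stable_of_lt_one` (`a·R⁺ < 1` ⇒
  locally exponentially stable modulo rotation ⇒ stable),
  ★★★ **`longLine_typeOne_auxJac_of_one_lt`** (`a·R⁺ > 1` ⇒ exactly ONE root of `−D⁻¹L(θ)` in
  the open right half-plane, `N − 2` in the left, one on the axis).
* §4 SWING network (`S : ClassicalModel.LosslessSystem n 0`, `Mᵢ, Dᵢ > 0`, any injections):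
  ★★ `longLine_criterion_of_stable_syncSolution`, ★★ `longLine_stable_syncSolution_of_lt_one`,
  ★★★ `longLine_typeOne_phaseJac_of_one_lt` (RHP = 1, LHP = (N − 2) + N, axis = 1).

THREE COLUMNS. CERTIFIED: kernel theorems — exact stability boundary `a·R⁺_eff(u ↔ v) = 1` for an
operating point with one line beyond `π/2` on ANY lossless topology, both model tiers, with the
type beyond it. MODELLED: lossless lines, constant voltages, first-order oscillators / droop
inverters and classical swing machines; `R⁺_eff` is the Levin–Peres effective resistance of the
short-line network (computable per instance from a unit voltage). NOT CLAIMED: several long lines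
(printed Theorems 1–3 with resistance MATRICES), the marginal case dynamically, lossy lines.
-/

noncomputable section

open Real Set Filter Topology Metric Finset Matrix
open scoped Matrix
open Literature.LinearAlgebra.Matrix (refMinor refMinor_isHermitian)
open Literature.Probability.MarkovChains

namespace Literature.MathematicalPhysics.PowerSystems

namespace SignedLaplacian

/-! ### §1. Zelazo–Bürger: a signed Laplacian with ONE negative edge `(u, v)` of weight `−a` on top
of a connected non-negative network `c` is positive semi-definite iff `a · R_eff(u ↔ v) ≤ 1`
(Dirichlet principle), with kernel `ℝ𝟙` iff `< 1`, and has exactly one negative eigenvalue iff `> 1` -/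

variable {X : Type*} [Fintype X] [DecidableEq X]

/-- **Dirichlet principle, homogeneous form**: on a connected network, for every potential `F`,
`(F(u) − F(v))² ≤ R(u ↔ v) · ½ΣΣ c(x,y)(F(x) − F(y))²`.
[cite: LevinPeres2017, §9.4 Thm 9.10 / Exercise (Dirichlet principle: `1/R(a ↔ z) = min{E(F) : F(a) = 1, F(z) = 0}`); ChenWangLiuBasarJohanssonQiu2016, §3 (effective resistance `r_eff(i,j) = u_ijᵀ L† u_ij`)] -/
theorem sq_sub_le_resistance_mul_dirichlet {c : Matrix X X ℝ} (hc : IsConductance c)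
    (hirr : Literature.Probability.MarkovChains.IsIrreducible (networkKernel c)) {u v : X} (huv : u ≠ v) (F : X → ℝ) :
    (F u - F v) ^ 2
      ≤ effectiveResistance c u v * (1 / 2 * ∑ x, ∑ y, c x y * (F x - F y) ^ 2) := by
  have hR := effectiveResistance_pos hc hirr huv
  have hE0 : 0 ≤ 1 / 2 * ∑ x, ∑ y, c x y * (F x - F y) ^ 2 :=
    mul_nonneg (by norm_num) (Finset.sum_nonneg fun x _ => Finset.sum_nonneg fun y _ =>
      mul_nonneg (hc.nonneg x y) (sq_nonneg _))
  by_cases hd : F u = F v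
  · rw [hd, sub_self, zero_pow two_ne_zero]
    exact mul_nonneg hR.le hE0
  · set d := F u - F v with hd'
    have hd0 : d ≠ 0 := sub_ne_zero.2 hd
    set G : X → ℝ := fun x => (F x - F v) / d with hG
    have hGu : G u = 1 := by simp only [hG, hd']; exact div_self hd0
    have hGv : G v = 0 := by simp [hG]
    have h := LyonsPeres2016_ex_2_13 hc hirr huv hGu hGv
    rw [flowEnergy_currentFlow_eq_dirichlet] at h
    have hEG : 1 / 2 * ∑ x, ∑ y, c x y * (G x - G y) ^ 2
        = (1 / 2 * ∑ x, ∑ y, c x y * (F x - F y) ^ 2) / d ^ 2 := by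
      rw [eq_div_iff (pow_ne_zero 2 hd0), mul_assoc, Finset.sum_mul]
      congr 1
      refine Finset.sum_congr rfl fun x _ => ?_
      rw [Finset.sum_mul]
      refine Finset.sum_congr rfl fun y _ => ?_
      simp only [hG]
      field_simp
      ring
    rw [hEG, le_div_iff₀ (by positivity)] at h
    -- `1/R · d² ≤ E`
    calc d ^ 2 = effectiveResistance c u v * (1 / effectiveResistance c u v * d ^ 2) := by
            field_simp
      _ ≤ effectiveResistance c u v * (1 / 2 * ∑ x, ∑ y, c x y * (F x - F y) ^ 2) :=
            mul_le_mul_of_nonneg_left h hR.le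

/-- ★★★ **Zelazo–Bürger's theorem (PSD half, as an iff)**: the one-negative-edge signed form
`½ΣΣ c(x,y)(F(x) − F(y))² − a(F(u) − F(v))²` (`c` a connected non-negative network, the extra edge
`(u, v)` of weight `−a`) is non-negative for every `F` IFF `a · R_eff(u ↔ v) ≤ 1` — «positive
semidefinite if, and only if, the effective resistance over the negatively weighted edge is
nonnegative», i.e. `|a| ≤ 1/r⁺_eff`. [cite: ChenWangLiuBasarJohanssonQiu2016, §1 (Zelazo and Bürger 2014, Thm III.3) and §4 Corollary 2 (doi:10.1016/j.ifacol.2016.10.379 p0002 L11, p0007 L1–L3); LevinPeres2017, §9.4 Thm 9.10] -/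
theorem form_nonneg_iff {c : Matrix X X ℝ} (hc : IsConductance c)
    (hirr : Literature.Probability.MarkovChains.IsIrreducible (networkKernel c)) {u v : X} (huv : u ≠ v) (a : ℝ) :
    (∀ F : X → ℝ, 0 ≤ 1 / 2 * ∑ x, ∑ y, c x y * (F x - F y) ^ 2 - a * (F u - F v) ^ 2)
      ↔ a * effectiveResistance c u v ≤ 1 := by
  have hR := effectiveResistance_pos hc hirr huv
  constructor
  · intro h
    obtain ⟨-, hWu, hWv⟩ := unitVoltage_spec hc hirr huv
    have hE := LyonsPeres2016_ex_2_13_eq hc hirr huv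
    rw [flowEnergy_currentFlow_eq_dirichlet] at hE
    have h1 := h (unitVoltage c u v)
    rw [hE, hWu, hWv, sub_zero, one_pow, mul_one] at h1
    -- `a ≤ 1/R`
    have : a * effectiveResistance c u v ≤ 1 / effectiveResistance c u v * effectiveResistance c u v :=
      mul_le_mul_of_nonneg_right (by linarith) hR.le
    rwa [one_div_mul_cancel hR.ne'] at this
  · intro h F
    have hDP := sq_sub_le_resistance_mul_dirichlet hc hirr huv F
    have hE0 : 0 ≤ 1 / 2 * ∑ x, ∑ y, c x y * (F x - F y) ^ 2 :=
      mul_nonneg (by norm_num) (Finset.sum_nonneg fun x _ => Finset.sum_nonneg fun y _ =>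
        mul_nonneg (hc.nonneg x y) (sq_nonneg _))
    -- `a (F u − F v)² ≤ a R E ≤ E`
    by_cases ha : 0 ≤ a
    · have h2 : a * (F u - F v) ^ 2
          ≤ a * (effectiveResistance c u v * (1 / 2 * ∑ x, ∑ y, c x y * (F x - F y) ^ 2)) :=
        mul_le_mul_of_nonneg_left hDP ha
      have h3 : a * (effectiveResistance c u v * (1 / 2 * ∑ x, ∑ y, c x y * (F x - F y) ^ 2))
          ≤ 1 * (1 / 2 * ∑ x, ∑ y, c x y * (F x - F y) ^ 2) := by
        rw [← mul_assoc]
        exact mul_le_mul_of_nonneg_right h hE0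
      linarith
    · have : a * (F u - F v) ^ 2 ≤ 0 :=
        mul_nonpos_of_nonpos_of_nonneg (not_le.1 ha).le (sq_nonneg _)
      linarith

/-- ★★ **Strict version: kernel = constants iff `a · R_eff(u ↔ v) < 1`** (sufficiency half: below the
threshold the signed form vanishes only on constant potentials).
[cite: ChenWangLiuBasarJohanssonQiu2016, §4 Corollary 2 («positive semidefinite and of corank(L) = 1 if, and only if, G is connected, and r⁺_eff(i,j) < 1/|a_ij|»)] -/
theorem const_of_form_eq_zero {c : Matrix X X ℝ} (hc : IsConductance c)
    (hirr : Literature.Probability.MarkovChains.IsIrreducible (networkKernel c)) {u v : X} (huv : u ≠ v) {a : ℝ}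
    (h : a * effectiveResistance c u v < 1) {F : X → ℝ}
    (hF : 1 / 2 * ∑ x, ∑ y, c x y * (F x - F y) ^ 2 - a * (F u - F v) ^ 2 = 0) (x y : X) :
    F x = F y := by
  have hR := effectiveResistance_pos hc hirr huv
  have hDP := sq_sub_le_resistance_mul_dirichlet hc hirr huv F
  set E := 1 / 2 * ∑ x, ∑ y, c x y * (F x - F y) ^ 2 with hEdef
  have hE0 : 0 ≤ E :=
    mul_nonneg (by norm_num) (Finset.sum_nonneg fun x _ => Finset.sum_nonneg fun y _ =>
      mul_nonneg (hc.nonneg x y) (sq_nonneg _))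
  -- `E = a d² ≤ a R E < E` unless `E = 0`
  have hEz : E = 0 := by
    by_contra hne
    have hEpos : 0 < E := lt_of_le_of_ne hE0 (Ne.symm hne)
    by_cases ha : 0 ≤ a
    · have h2 : a * (F u - F v) ^ 2 ≤ a * (effectiveResistance c u v * E) :=
        mul_le_mul_of_nonneg_left hDP ha
      have h3 : a * (effectiveResistance c u v * E) < 1 * E := by
        rw [← mul_assoc]; exact mul_lt_mul_of_pos_right h hEpos
      linarith
    · have : a * (F u - F v) ^ 2 ≤ 0 :=
        mul_nonpos_of_nonpos_of_nonneg (not_le.1 ha).le (sq_nonneg _)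
      linarith
  have hE' : flowEnergy c (currentFlow c F) = 0 := by
    rw [flowEnergy_currentFlow_eq_dirichlet]; exact hEz
  exact eq_of_flowEnergy_currentFlow_eq_zero hc hirr hE' x y

/-- **Beyond the threshold the unit voltage is a negative direction**: `a · R_eff > 1 ⇒` the signed
form is negative at `W₁` (value `1/R − a`). [cite: ChenWangLiuBasarJohanssonQiu2016, §4 Corollary 2 and §3 (unit current / voltage); LevinPeres2017, §9.4 Thm 9.10 (`E(I) = R(a ↔ z)`)] -/
theorem exists_form_neg_of_one_lt {c : Matrix X X ℝ} (hc : IsConductance c)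
    (hirr : Literature.Probability.MarkovChains.IsIrreducible (networkKernel c)) {u v : X} (huv : u ≠ v) {a : ℝ}
    (h : 1 < a * effectiveResistance c u v) :
    ∃ F : X → ℝ, 1 / 2 * ∑ x, ∑ y, c x y * (F x - F y) ^ 2 - a * (F u - F v) ^ 2 < 0 := by
  have hR := effectiveResistance_pos hc hirr huv
  obtain ⟨-, hWu, hWv⟩ := unitVoltage_spec hc hirr huv
  have hE := LyonsPeres2016_ex_2_13_eq hc hirr huv
  rw [flowEnergy_currentFlow_eq_dirichlet] at hE
  refine ⟨unitVoltage c u v, ?_⟩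
  rw [hE, hWu, hWv, sub_zero, one_pow, mul_one, sub_neg]
  rw [← div_lt_iff₀ hR] at h
  exact h

/-- **At the threshold the unit voltage is a non-constant kernel vector** (`a · R_eff = 1`): the
corank-1 clause of Corollary 2 needs the STRICT inequality.
[cite: ChenWangLiuBasarJohanssonQiu2016, §4 Corollary 2] -/
theorem exists_nonconst_form_eq_zero_of_eq_one {c : Matrix X X ℝ} (hc : IsConductance c)
    (hirr : Literature.Probability.MarkovChains.IsIrreducible (networkKernel c)) {u v : X} (huv : u ≠ v) {a : ℝ}
    (h : a * effectiveResistance c u v = 1) :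
    ∃ F : X → ℝ, F u ≠ F v ∧
      1 / 2 * ∑ x, ∑ y, c x y * (F x - F y) ^ 2 - a * (F u - F v) ^ 2 = 0 := by
  have hR := effectiveResistance_pos hc hirr huv
  obtain ⟨-, hWu, hWv⟩ := unitVoltage_spec hc hirr huv
  have hE := LyonsPeres2016_ex_2_13_eq hc hirr huv
  rw [flowEnergy_currentFlow_eq_dirichlet] at hE
  refine ⟨unitVoltage c u v, by rw [hWu, hWv]; exact one_ne_zero, ?_⟩
  rw [hE, hWu, hWv, sub_zero, one_pow, mul_one]
  have : a = 1 / effectiveResistance c u v := by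
    rw [eq_div_iff hR.ne']; exact h
  rw [this, sub_self]

/-- Translation-invariant forms annihilate the constants. [folklore] -/
private theorem mulVec_one_eq_zero {H : Matrix X X ℝ} (hH : H.IsHermitian) {Q : (X → ℝ) → ℝ}
    (hform : ∀ x : X → ℝ, x ⬝ᵥ H *ᵥ x = Q x) (hQ : ∀ x : X → ℝ, Q (x + fun _ => 1) = Q x) :
    H *ᵥ (fun _ => (1 : ℝ)) = 0 := by
  have hT : Hᵀ = H := Literature.Analysis.Matrix.KyFan.transpose_eq hH
  have hsymm : ∀ x y : X → ℝ, x ⬝ᵥ H *ᵥ y = y ⬝ᵥ H *ᵥ x := by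
    intro x y
    rw [dotProduct_mulVec, ← mulVec_transpose, hT, dotProduct_comm]
  have hpol : ∀ x y : X → ℝ,
      (x + y) ⬝ᵥ H *ᵥ (x + y) = x ⬝ᵥ H *ᵥ x + 2 * (x ⬝ᵥ H *ᵥ y) + y ⬝ᵥ H *ᵥ y := by
    intro x y
    rw [mulVec_add, add_dotProduct, dotProduct_add, dotProduct_add, hsymm y x]
    ring
  have hinv : ∀ x : X → ℝ, (x + fun _ => (1 : ℝ)) ⬝ᵥ H *ᵥ (x + fun _ => (1 : ℝ))
      = x ⬝ᵥ H *ᵥ x := by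
    intro x; rw [hform, hform, hQ]
  have hone : (fun _ : X => (1 : ℝ)) ⬝ᵥ H *ᵥ (fun _ => (1 : ℝ)) = 0 := by
    have := hinv 0
    rw [zero_add, mulVec_zero, dotProduct_zero] at this
    exact this
  have horth : ∀ x : X → ℝ, x ⬝ᵥ H *ᵥ (fun _ => (1 : ℝ)) = 0 := by
    intro x
    have := hpol x (fun _ => 1)
    rw [hinv x, hone] at this
    linarith
  funext i
  have := horth (Pi.single i 1)
  rw [single_one_dotProduct] at this
  exact this

/-- ★★ **INERTIA beyond the threshold**: for a real symmetric `H` carrying the one-negative-edge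
signed form on a connected non-negative network, `a · R_eff(u ↔ v) > 1 ⇒ n₋(H) = 1, n₀(H) = 1,
n₊(H) = |X| − 2` — exactly one negative eigenvalue (the negative edge is a rank-one perturbation).
[cite: ChenWangLiuBasarJohanssonQiu2016, §4 Corollary 2 and §5 (Sylvester inertia of `J(θ₀)` vs `−L(θ₀)`); HornJohnson2013, Theorem 4.2.10] -/
theorem inertia_of_one_lt {c : Matrix X X ℝ} (hc : IsConductance c)
    (hirr : Literature.Probability.MarkovChains.IsIrreducible (networkKernel c)) {u v : X} (huv : u ≠ v) {a : ℝ}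
    {H : Matrix X X ℝ} (hH : H.IsHermitian)
    (hform : ∀ F : X → ℝ, F ⬝ᵥ H *ᵥ F
      = 1 / 2 * ∑ x, ∑ y, c x y * (F x - F y) ^ 2 - a * (F u - F v) ^ 2)
    (h : 1 < a * effectiveResistance c u v) :
    (univ.filter fun i => hH.eigenvalues i < 0).card = 1
      ∧ (univ.filter fun i => hH.eigenvalues i = 0).card = 1
      ∧ (univ.filter fun i => 0 < hH.eigenvalues i).card = Fintype.card X - 2 := by
  classical
  have hE0 : ∀ F : X → ℝ, 0 ≤ 1 / 2 * ∑ x, ∑ y, c x y * (F x - F y) ^ 2 := fun F =>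
    mul_nonneg (by norm_num) (Finset.sum_nonneg fun x _ => Finset.sum_nonneg fun y _ =>
      mul_nonneg (hc.nonneg x y) (sq_nonneg _))
  -- (1) `n₋ ≤ 1`
  let L1 : (X → ℝ) →ₗ[ℝ] ℝ :=
    { toFun := fun F => F u - F v
      map_add' := fun x y => by simp only [Pi.add_apply]; ring
      map_smul' := fun r x => by simp only [Pi.smul_apply, smul_eq_mul, RingHom.id_apply]; ring }
  have c1 := NonuniformKuramoto.card_eigenvalues_neg_le_of_nonneg_on_ker hH L1
    (le_of_eq (Module.finrank_self ℝ)) fun F hF => by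
      have hF' : F u - F v = 0 := hF
      rw [hform, hF']
      simpa using hE0 F
  -- (2) `#{λ ≤ 0} ≤ 2`
  let L2 : (X → ℝ) →ₗ[ℝ] (Fin 2 → ℝ) :=
    { toFun := fun F => ![F u - F v, F u]
      map_add' := fun x y => by
        funext i; fin_cases i
        · simp [Pi.add_apply]; ring
        · simp [Pi.add_apply]
      map_smul' := fun r x => by
        funext i; fin_cases i
        · simp [Pi.smul_apply, smul_eq_mul]; ring
        · simp [Pi.smul_apply, smul_eq_mul] }
  have c2 := NonuniformKuramoto.card_eigenvalues_nonpos_le_of_pos_on_ker hH L2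
    (le_of_eq (Module.finrank_fin_fun ℝ)) fun F hF0 hF => by
      have hFa : F u - F v = 0 := by have := congrFun hF 0; simpa [L2] using this
      have hFb : F u = 0 := by have := congrFun hF 1; simpa [L2] using this
      rw [hform, hFa]
      simp only [zero_pow two_ne_zero, mul_zero, sub_zero]
      refine (hE0 F).lt_of_ne fun hE => hF0 ?_
      have hE' : flowEnergy c (currentFlow c F) = 0 := by
        rw [flowEnergy_currentFlow_eq_dirichlet]; exact hE.symm
      funext x
      rw [Pi.zero_apply, eq_of_flowEnergy_currentFlow_eq_zero hc hirr hE' x u]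
      exact hFb
  -- (3) `n₋ ≥ 1`
  have c3 : 1 ≤ (univ.filter fun i => hH.eigenvalues i < 0).card := by
    by_contra hlt
    have h0 : (univ.filter fun i => hH.eigenvalues i < 0).card = 0 := by omega
    obtain ⟨F, hF⟩ := exists_form_neg_of_one_lt hc hirr huv h
    rw [← hform, Literature.Analysis.Matrix.KyFan.dotProduct_mulVec_eq_sum_eigen hH F] at hF
    refine absurd hF (not_lt.2 (Finset.sum_nonneg fun i _ => mul_nonneg ?_ (sq_nonneg _)))
    by_contra hneg
    have : i ∈ (univ.filter fun i => hH.eigenvalues i < 0) := by simp [not_le.1 hneg]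
    rw [Finset.card_eq_zero.1 h0] at this
    simp at this
  -- (4) `n₀ ≥ 1`
  have c4 : 1 ≤ (univ.filter fun i => hH.eigenvalues i = 0).card := by
    haveI : Nonempty X := ⟨u⟩
    have h1 : H *ᵥ (fun _ => (1 : ℝ)) = 0 :=
      mulVec_one_eq_zero hH hform fun x => by simp only [Pi.add_apply, add_sub_add_right_eq_sub]
    have hdet : H.det = 0 :=
      Matrix.exists_mulVec_eq_zero_iff.1 ⟨fun _ => 1, fun h0 => by simpa using congrFun h0 u, h1⟩
    have hprod := hH.det_eq_prod_eigenvalues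
    rw [hdet] at hprod
    simp only [RCLike.ofReal_real_eq_id, id_eq] at hprod
    obtain ⟨i, _, hi⟩ := Finset.prod_eq_zero_iff.1 hprod.symm
    exact Finset.card_pos.2 ⟨i, by simp [hi]⟩
  -- partitions
  have e1 : (univ.filter fun i => hH.eigenvalues i ≤ 0).card
      = (univ.filter fun i => hH.eigenvalues i < 0).card
        + (univ.filter fun i => hH.eigenvalues i = 0).card := by
    rw [← Finset.card_union_of_disjoint]
    · congr 1
      ext i
      simp only [Finset.mem_filter, Finset.mem_univ, true_and, Finset.mem_union]
      constructor
      · intro hi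
        rcases hi.lt_or_eq with hi | hi
        · exact Or.inl hi
        · exact Or.inr hi
      · rintro (hi | hi)
        · exact hi.le
        · rw [hi]
    · exact Finset.disjoint_filter.2 fun i _ h1 h2 => by rw [h2] at h1; exact lt_irrefl _ h1
  have e2 : (univ.filter fun i => hH.eigenvalues i ≤ 0).card
      + (univ.filter fun i => 0 < hH.eigenvalues i).card = Fintype.card X := by
    have hh := Finset.card_filter_add_card_filter_not
      (s := (univ : Finset X)) (fun i => hH.eigenvalues i ≤ 0)
    have e : (univ.filter fun i => ¬ hH.eigenvalues i ≤ 0)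
        = (univ.filter fun i => 0 < hH.eigenvalues i) := by
      ext i; simp
    rw [e, Finset.card_univ] at hh
    exact hh
  refine ⟨by omega, by omega, by omega⟩

/-! ### §2. The linearised form of an oscillator network with ONE long line `(u, v)` is the
one-negative-edge signed form over the network of the other (short) lines -/

omit [DecidableEq X] in
/-- Half-sum-of-squares form of a symmetric weighted Laplacian form. [folklore] -/
private theorem linForm_eq_half_sum_sq' (W : X → X → ℝ) (hW : ∀ i j, W i j = W j i) (x : X → ℝ) :
    ∑ i, x i * ∑ j, W i j * (x i - x j) = 1 / 2 * ∑ i, ∑ j, W i j * (x i - x j) ^ 2 := by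
  have h1 : ∑ i, x i * ∑ j, W i j * (x i - x j) = ∑ i, ∑ j, W i j * (x i * (x i - x j)) := by
    refine Finset.sum_congr rfl fun i _ => ?_
    rw [Finset.mul_sum]
    exact Finset.sum_congr rfl fun j _ => by ring
  have h2 : ∑ i, ∑ j, W i j * (x i * (x i - x j)) = ∑ i, ∑ j, W i j * (x j * (x j - x i)) := by
    rw [Finset.sum_comm]
    exact Finset.sum_congr rfl fun i _ => Finset.sum_congr rfl fun j _ => by rw [hW]
  have h3 : ∑ i, ∑ j, W i j * (x i - x j) ^ 2
      = ∑ i, ∑ j, W i j * (x i * (x i - x j)) + ∑ i, ∑ j, W i j * (x j * (x j - x i)) := by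
    rw [← Finset.sum_add_distrib]
    refine Finset.sum_congr rfl fun i _ => ?_
    rw [← Finset.sum_add_distrib]
    exact Finset.sum_congr rfl fun j _ => by ring
  rw [h1, h3, ← h2]; ring

/-- **Splitting off one line**: with `c⁺` the symmetric weight matrix `W` with the diagonal and the
pair `{u, v}` zeroed, `Σᵢ xᵢ Σⱼ Wᵢⱼ(xᵢ − xⱼ) = ½ΣΣ c⁺(x,y)(F(x) − F(y))² + W_{uv}(x_u − x_v)²` — the
signed graph `G = G⁺ ∪ {(u,v)}`. [cite: ChenWangLiuBasarJohanssonQiu2016, §4 («G = F ∪ C», `L = L⁺ + L⁻` decomposition of the signed Laplacian by edge sign)] -/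
theorem linForm_eq_posPart_add {W : X → X → ℝ} (hW : ∀ i j, W i j = W j i) {u v : X} (huv : u ≠ v)
    {cp : Matrix X X ℝ}
    (hcp : ∀ i j, cp i j = if i = j then 0 else if (i = u ∧ j = v) ∨ (i = v ∧ j = u) then 0 else W i j)
    (x : X → ℝ) :
    ∑ i, x i * ∑ j, W i j * (x i - x j)
      = 1 / 2 * ∑ i, ∑ j, cp i j * (x i - x j) ^ 2 - (-W u v) * (x u - x v) ^ 2 := by
  classical
  rw [linForm_eq_half_sum_sq' W hW x]
  -- termwise: `W_ij (x_i − x_j)² = c⁺_ij (x_i − x_j)² + [pair term]`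
  have hterm : ∀ i j, W i j * (x i - x j) ^ 2
      = cp i j * (x i - x j) ^ 2
        + (if (i = u ∧ j = v) ∨ (i = v ∧ j = u) then W i j * (x i - x j) ^ 2 else 0) := by
    intro i j
    rw [hcp]
    by_cases hij : i = j
    · subst hij; simp
    · rw [if_neg hij]
      by_cases hp : (i = u ∧ j = v) ∨ (i = v ∧ j = u)
      · rw [if_pos hp, if_pos hp]; ring
      · rw [if_neg hp, if_neg hp]; ring
  have hpair : ∑ i, ∑ j, (if (i = u ∧ j = v) ∨ (i = v ∧ j = u) then W i j * (x i - x j) ^ 2 else 0)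
      = 2 * (W u v * (x u - x v) ^ 2) := by
    have hrow : ∀ i, ∑ j, (if (i = u ∧ j = v) ∨ (i = v ∧ j = u) then W i j * (x i - x j) ^ 2 else 0)
        = (if i = u then W u v * (x u - x v) ^ 2 else 0)
          + (if i = v then W v u * (x v - x u) ^ 2 else 0) := by
      intro i
      by_cases hiu : i = u
      · have hiv : i ≠ v := fun h => huv (hiu.symm.trans h)
        rw [if_pos hiu, if_neg hiv, add_zero,
          Finset.sum_eq_single_of_mem v (Finset.mem_univ v) (fun j _ hj => by
            rw [if_neg]
            rintro (⟨-, h⟩ | ⟨h, -⟩)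
            · exact hj h
            · exact hiv h),
          if_pos (Or.inl ⟨hiu, rfl⟩), hiu]
      · rw [if_neg hiu, zero_add]
        by_cases hiv : i = v
        · rw [if_pos hiv,
            Finset.sum_eq_single_of_mem u (Finset.mem_univ u) (fun j _ hj => by
              rw [if_neg]
              rintro (⟨h, -⟩ | ⟨-, h⟩)
              · exact hiu h
              · exact hj h),
            if_pos (Or.inr ⟨hiv, rfl⟩), hiv]
        · rw [if_neg hiv]
          refine Finset.sum_eq_zero fun j _ => ?_
          rw [if_neg]
          rintro (⟨h, -⟩ | ⟨h, -⟩)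
          · exact hiu h
          · exact hiv h
    rw [Finset.sum_congr rfl fun i _ => hrow i, Finset.sum_add_distrib, Finset.sum_ite_eq',
      Finset.sum_ite_eq']
    simp only [Finset.mem_univ, if_true]
    rw [hW v u]; ring
  have hsplit : ∑ i, ∑ j, W i j * (x i - x j) ^ 2
      = ∑ i, ∑ j, cp i j * (x i - x j) ^ 2 + 2 * (W u v * (x u - x v) ^ 2) := by
    rw [← hpair, ← Finset.sum_add_distrib]
    refine Finset.sum_congr rfl fun i _ => ?_
    rw [← Finset.sum_add_distrib]
    exact Finset.sum_congr rfl fun j _ => hterm i j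
  rw [hsplit]; ring

end SignedLaplacian

/-! ### §3. THE MODEL: first-order Kuramoto / droop network (ANY topology) with ONE long line -/

namespace NonuniformKuramoto

variable {n : ℕ} (Kur : NonuniformKuramoto n)

/-- ★★★ **ZELAZO–BÜRGER / CHEN ET AL. FOR AN OSCILLATOR NETWORK WITH ONE LONG LINE, print's notion.**
MODEL: first-order Kuramoto oscillators / droop inverters, lossless, symmetric coupling on ANY
topology, ANY natural frequencies, ANY `Dᵢ > 0`; a configuration `θ` and a distinguished line
`(u, v)`; `c⁺` := the cosine-weight matrix `Pᵢⱼcos(θᵢ − θⱼ)` of the OTHER lines (diagonal and the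
pair `{u,v}` zeroed), assumed a connected non-negative network (`IsConductance`, `IsIrreducible`: all
other lines short, every node on a short line, `G⁺` connected); `a := −P_{uv}cos(θ_u − θ_v)` (the
interesting case `a > 0`: the line `(u,v)` loaded beyond `π/2`). Then the stability matrix `−L(θ)` is
negative semi-definite IFF `a · R⁺_eff(u ↔ v) ≤ 1`, `R⁺_eff` the effective resistance of `c⁺`
between `u` and `v` (Levin–Peres `effectiveResistance`).
[cite: ChenWangLiuBasarJohanssonQiu2016, §1 (Zelazo–Bürger 2014 Thm III.3), §4 Corollary 2, §5 («θ₀ is small-disturbance stable if, and only if, L(θ₀) is positive semidefinite and has a simple zero eigenvalue») (doi:10.1016/j.ifacol.2016.10.379 p0002, p0007–p0008); LevinPeres2017, §9.4 Thm 9.10] -/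
theorem longLine_stabilityMatrix_negSemidef_iff (hP : ∀ i j, Kur.P i j = Kur.P j i) {u v : Fin n}
    (huv : u ≠ v) (θ : Fin n → ℝ) {cp : Matrix (Fin n) (Fin n) ℝ}
    (hcp : ∀ i j, cp i j = if i = j then 0 else if (i = u ∧ j = v) ∨ (i = v ∧ j = u) then 0
      else Kur.P i j * Real.cos (θ i - θ j))
    (hc : IsConductance cp) (hirr : Literature.Probability.MarkovChains.IsIrreducible (networkKernel cp)) :
    (∀ z : Fin n → ℝ, z ⬝ᵥ ((-Kur.toDroopNetwork.lap θ) *ᵥ z) ≤ 0)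
      ↔ -(Kur.P u v * Real.cos (θ u - θ v)) * effectiveResistance cp u v ≤ 1 := by
  have hw : ∀ i j, Kur.P i j * Real.cos (θ i - θ j) = Kur.P j i * Real.cos (θ j - θ i) := by
    intro i j; rw [hP i j, ← Real.cos_neg, neg_sub]
  rw [Kur.stabilityMatrix_negSemidef_iff_linForm_nonneg]
  simp only [SignedLaplacian.linForm_eq_posPart_add hw huv hcp]
  exact SignedLaplacian.form_nonneg_iff hc hirr huv _

/-- ★★ **Strict version: `−L(θ)` negative definite off the rotation IFF `a · R⁺_eff(u ↔ v) < 1`.**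
[cite: ChenWangLiuBasarJohanssonQiu2016, §4 Corollary 2 («positive semidefinite and of corank(L) = 1 if, and only if, G is connected, and r⁺_eff(i,j) < 1/|a_ij|»)] -/
theorem longLine_stabilityMatrix_negDef_iff (hP : ∀ i j, Kur.P i j = Kur.P j i) {u v : Fin n}
    (huv : u ≠ v) (θ : Fin n → ℝ) {cp : Matrix (Fin n) (Fin n) ℝ}
    (hcp : ∀ i j, cp i j = if i = j then 0 else if (i = u ∧ j = v) ∨ (i = v ∧ j = u) then 0
      else Kur.P i j * Real.cos (θ i - θ j))
    (hc : IsConductance cp) (hirr : Literature.Probability.MarkovChains.IsIrreducible (networkKernel cp)) :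
    (∀ z : Fin n → ℝ, (¬ ∃ c : ℝ, z = fun _ => c) → z ⬝ᵥ ((-Kur.toDroopNetwork.lap θ) *ᵥ z) < 0)
      ↔ -(Kur.P u v * Real.cos (θ u - θ v)) * effectiveResistance cp u v < 1 := by
  have hw : ∀ i j, Kur.P i j * Real.cos (θ i - θ j) = Kur.P j i * Real.cos (θ j - θ i) := by
    intro i j; rw [hP i j, ← Real.cos_neg, neg_sub]
  rw [Kur.stabilityMatrix_negDef_iff_linForm_pos]
  simp only [SignedLaplacian.linForm_eq_posPart_add hw huv hcp]
  set a := -(Kur.P u v * Real.cos (θ u - θ v)) with ha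
  constructor
  · intro h
    rcases lt_trichotomy (a * effectiveResistance cp u v) 1 with hlt | heq | hgt
    · exact hlt
    · exfalso
      obtain ⟨F, hne, hF⟩ := SignedLaplacian.exists_nonconst_form_eq_zero_of_eq_one hc hirr huv heq
      have hnc : ¬ ∃ c : ℝ, F = fun _ => c := by
        rintro ⟨c, hc'⟩; exact hne (by rw [hc'])
      exact absurd (h F hnc) (by rw [hF]; exact lt_irrefl 0)
    · exfalso
      obtain ⟨F, hF⟩ := SignedLaplacian.exists_form_neg_of_one_lt hc hirr huv hgt
      have hnc : ¬ ∃ c : ℝ, F = fun _ => c := by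
        rintro ⟨c, hc'⟩
        rw [hc'] at hF
        simp at hF
      exact absurd (h F hnc) (not_lt.2 hF.le)
  · intro h F hF
    refine ((SignedLaplacian.form_nonneg_iff hc hirr huv a).2 h.le F).lt_of_ne fun h0 => hF ?_
    exact ⟨F u, funext fun i => SignedLaplacian.const_of_form_eq_zero hc hirr huv h h0.symm i u⟩

/-- ★★ **Lyapunov reading, necessity**: a Lyapunov-stable phase-locked solution with one long line
satisfies `a · R⁺_eff(u ↔ v) ≤ 1`. [cite: ChenWangLiuBasarJohanssonQiu2016, §5 and §4 Corollary 2; ManikTimmeWitthaut2017, §2 Lemma 1] -/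
theorem longLine_criterion_of_lockedSolution_stable (hD : ∀ i, 0 < Kur.D i)
    (hφ : ∀ i j, Kur.φ i j = 0) (hP : ∀ i j, Kur.P i j = Kur.P j i) {u v : Fin n} (huv : u ≠ v)
    {θu : Fin n → ℝ} (hθu : ∀ i, Kur.field θu i = (∑ j, Kur.ω j) / ∑ j, Kur.D j)
    {cp : Matrix (Fin n) (Fin n) ℝ}
    (hcp : ∀ i j, cp i j = if i = j then 0 else if (i = u ∧ j = v) ∨ (i = v ∧ j = u) then 0
      else Kur.P i j * Real.cos (θu i - θu j))
    (hc : IsConductance cp) (hirr : Literature.Probability.MarkovChains.IsIrreducible (networkKernel cp))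
    (hst : ∀ ε > 0, ∃ δ > 0, ∀ x₁ : Fin n → ℝ, ‖x₁ - θu‖ < δ → ∀ θ : ℝ → Fin n → ℝ,
      θ 0 = x₁ → (∀ T : ℝ, ∀ t ∈ Icc 0 T, HasDerivWithinAt θ (Kur.field (θ t)) (Icc 0 T) t) →
      ∀ t, 0 ≤ t → ‖θ t - fun i => θu i + (∑ j, Kur.ω j) / (∑ j, Kur.D j) * t‖ < ε) :
    -(Kur.P u v * Real.cos (θu u - θu v)) * effectiveResistance cp u v ≤ 1 :=
  (Kur.longLine_stabilityMatrix_negSemidef_iff hP huv θu hcp hc hirr).1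
    (Kur.stabilityMatrix_negSemidef_of_lockedSolution_stable hD hφ hP hθu hst)

/-- ★★ **Lyapunov reading, sufficiency**: `a · R⁺_eff(u ↔ v) < 1` makes the phase-locked solution
locally exponentially stable modulo rotation — a STABLE operating point with a line beyond `π/2`
on an arbitrary topology. [cite: ChenWangLiuBasarJohanssonQiu2016, §5 («critical lines across which the angle differences are greater than π/2») and §4 Corollary 2; ManikTimmeWitthaut2017, §2 Lemma 1] -/
theorem longLine_lockedSolution_locally_expStable_of_lt_one (hD : ∀ i, 0 < Kur.D i)
    (hφ : ∀ i j, Kur.φ i j = 0) (hP : ∀ i j, Kur.P i j = Kur.P j i) {u v : Fin n} (huv : u ≠ v)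
    {θ₀ : Fin n → ℝ} (hθ₀ : ∀ i, Kur.field θ₀ i = (∑ j, Kur.ω j) / ∑ j, Kur.D j)
    {cp : Matrix (Fin n) (Fin n) ℝ}
    (hcp : ∀ i j, cp i j = if i = j then 0 else if (i = u ∧ j = v) ∨ (i = v ∧ j = u) then 0
      else Kur.P i j * Real.cos (θ₀ i - θ₀ j))
    (hc : IsConductance cp) (hirr : Literature.Probability.MarkovChains.IsIrreducible (networkKernel cp))
    (hlt : -(Kur.P u v * Real.cos (θ₀ u - θ₀ v)) * effectiveResistance cp u v < 1) :
    ∃ ρ > 0, ∃ C > 0, ∃ lam > 0, ∀ (θ : ℝ → Fin n → ℝ) (T : ℝ),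
      (∀ t ∈ Icc 0 T, HasDerivWithinAt θ (Kur.field (θ t)) (Icc 0 T) t) → ‖θ 0 - θ₀‖ < ρ →
      ∀ t ∈ Icc 0 T,
        ‖θ t - fun i => θ₀ i + Kur.D ⬝ᵥ (θ 0 - θ₀) / (∑ i, Kur.D i) + (∑ j, Kur.ω j) / (∑ j, Kur.D j) * t‖
          ≤ C * ‖θ 0 - fun i => θ₀ i + Kur.D ⬝ᵥ (θ 0 - θ₀) / ∑ i, Kur.D i‖ * Real.exp (-lam * t) := by
  have hw : ∀ i j, Kur.P i j * Real.cos (θ₀ i - θ₀ j) = Kur.P j i * Real.cos (θ₀ j - θ₀ i) := by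
    intro i j; rw [hP i j, ← Real.cos_neg, neg_sub]
  exact Kur.lockedSolution_locally_expStable_of_posCurvature hD hφ hP hθ₀
    (fun x => by
      rw [SignedLaplacian.linForm_eq_posPart_add hw huv hcp]
      exact (SignedLaplacian.form_nonneg_iff hc hirr huv _).2 hlt.le x)
    (fun x hx => by
      rw [SignedLaplacian.linForm_eq_posPart_add hw huv hcp] at hx
      exact ⟨x u, funext fun i => SignedLaplacian.const_of_form_eq_zero hc hirr huv hlt hx i u⟩)

/-- ★★ … hence LYAPUNOV-STABLE: `< 1 ⇒` stable `⇒ ≤ 1`. [cite: ChenWangLiuBasarJohanssonQiu2016, §5, §4 Corollary 2] -/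
theorem longLine_lockedSolution_stable_of_lt_one (hD : ∀ i, 0 < Kur.D i)
    (hφ : ∀ i j, Kur.φ i j = 0) (hP : ∀ i j, Kur.P i j = Kur.P j i) {u v : Fin n} (huv : u ≠ v)
    {θu : Fin n → ℝ} (hθu : ∀ i, Kur.field θu i = (∑ j, Kur.ω j) / ∑ j, Kur.D j)
    {cp : Matrix (Fin n) (Fin n) ℝ}
    (hcp : ∀ i j, cp i j = if i = j then 0 else if (i = u ∧ j = v) ∨ (i = v ∧ j = u) then 0
      else Kur.P i j * Real.cos (θu i - θu j))
    (hc : IsConductance cp) (hirr : Literature.Probability.MarkovChains.IsIrreducible (networkKernel cp))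
    (hlt : -(Kur.P u v * Real.cos (θu u - θu v)) * effectiveResistance cp u v < 1) :
    ∀ ε > 0, ∃ δ > 0, ∀ x₁ : Fin n → ℝ, ‖x₁ - θu‖ < δ → ∀ θ : ℝ → Fin n → ℝ,
      θ 0 = x₁ → (∀ T : ℝ, ∀ t ∈ Icc 0 T, HasDerivWithinAt θ (Kur.field (θ t)) (Icc 0 T) t) →
      ∀ t, 0 ≤ t → ‖θ t - fun i => θu i + (∑ j, Kur.ω j) / (∑ j, Kur.D j) * t‖ < ε :=
  Kur.lockedSolution_stable_of_locally_expStable hD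
    (Kur.longLine_lockedSolution_locally_expStable_of_lt_one hD hφ hP huv hθu hcp hc hirr hlt)

/-- ★★★ **Beyond the threshold: a TYPE-1 saddle.** If `a · R⁺_eff(u ↔ v) > 1` then the Jacobian
`−D⁻¹L(θ)` (any `Dᵢ > 0`) has exactly ONE characteristic root in the open right half-plane,
`N − 2` in the open left half-plane and one on the imaginary axis.
[cite: ChenWangLiuBasarJohanssonQiu2016, §5 (Sylvester inertia of `J(θ₀)` vs `−L(θ₀)`) and §4 Corollary 2; Chiang1995, §6 Theorem 6.7 (R1)] -/
theorem longLine_typeOne_auxJac_of_one_lt (hD : ∀ i, 0 < Kur.D i)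
    (hP : ∀ i j, Kur.P i j = Kur.P j i) {u v : Fin n} (huv : u ≠ v) (θ : Fin n → ℝ)
    {cp : Matrix (Fin n) (Fin n) ℝ}
    (hcp : ∀ i j, cp i j = if i = j then 0 else if (i = u ∧ j = v) ∨ (i = v ∧ j = u) then 0
      else Kur.P i j * Real.cos (θ i - θ j))
    (hc : IsConductance cp) (hirr : Literature.Probability.MarkovChains.IsIrreducible (networkKernel cp))
    (hgt : 1 < -(Kur.P u v * Real.cos (θ u - θ v)) * effectiveResistance cp u v) :
    ((Kur.toDroopNetwork.auxJac θ).map (algebraMap ℝ ℂ)).charpoly.roots.countP (fun μ => 0 < μ.re)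
        = 1
      ∧ ((Kur.toDroopNetwork.auxJac θ).map (algebraMap ℝ ℂ)).charpoly.roots.countP (fun μ => μ.re < 0)
        = n - 2
      ∧ ((Kur.toDroopNetwork.auxJac θ).map (algebraMap ℝ ℂ)).charpoly.roots.countP (fun μ => μ.re = 0)
        = 1 := by
  classical
  have hw : ∀ i j, Kur.P i j * Real.cos (θ i - θ j) = Kur.P j i * Real.cos (θ j - θ i) := by
    intro i j; rw [hP i j, ← Real.cos_neg, neg_sub]
  have hL : (Kur.toDroopNetwork.lap θ).IsHermitian :=
    DroopNetwork.lap_isHermitian (N := Kur.toDroopNetwork) (fun i j => hP i j) θ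
  have hrow : ∀ i, ∑ l, Kur.toDroopNetwork.lap θ i l = 0 :=
    fun i => DroopNetwork.sum_lap_row (N := Kur.toDroopNetwork) θ i
  have hform : ∀ x : Fin n → ℝ, x ⬝ᵥ Kur.toDroopNetwork.lap θ *ᵥ x
      = 1 / 2 * ∑ i, ∑ j, cp i j * (x i - x j) ^ 2
        - (-(Kur.P u v * Real.cos (θ u - θ v))) * (x u - x v) ^ 2 := by
    intro x
    rw [Kur.dotProduct_lap_mulVec]
    simp only [toDroopNetwork_linWeight]
    exact SignedLaplacian.linForm_eq_posPart_add hw huv hcp x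
  obtain ⟨h1, h2, h3⟩ := SignedLaplacian.inertia_of_one_lt hc hirr huv hL hform hgt
  have hHm := refMinor_isHermitian hL u
  obtain ⟨r1, r2, -, hreg⟩ := RefNode.refMinor_counts hL hrow h2 u hHm
  obtain ⟨t1, t2, t3⟩ := Kur.countP_roots_charpoly_toDroopNetwork_auxJac hP hD θ u hHm hreg
  refine ⟨?_, ?_, t3⟩
  · rw [t1, r2, h1]
  · rw [t2, r1, h3, Fintype.card_fin]

end NonuniformKuramoto

/-! ### §4. The classical swing model (any topology) with ONE long line -/

namespace ClassicalModel

namespace LosslessSystem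

variable {n : ℕ} (S : LosslessSystem n 0)

/-- ★★ **Swing model, necessity**: a Lyapunov-stable synchronous solution with one long line
satisfies `a · R⁺_eff(u ↔ v) ≤ 1`. [cite: ChenWangLiuBasarJohanssonQiu2016, §4 Corollary 2; ManikTimmeWitthaut2017, §3 Lemma 1] -/
theorem longLine_criterion_of_stable_syncSolution (hC : ∀ i j, S.C i j = S.C j i) {u v : Fin n}
    (huv : u ≠ v) (hM : ∀ i, 0 < S.M i) (hD : ∀ i, 0 < S.D i) {θe : Fin n → ℝ}
    (he : ∀ i, S.P i - S.D i * ((∑ j, S.P j) / ∑ j, S.D j) = S.flow θe i)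
    {cp : Matrix (Fin n) (Fin n) ℝ}
    (hcp : ∀ i j, cp i j = if i = j then 0 else if (i = u ∧ j = v) ∨ (i = v ∧ j = u) then 0
      else S.C i j * Real.cos (θe i - θe j))
    (hc : IsConductance cp) (hirr : Literature.Probability.MarkovChains.IsIrreducible (networkKernel cp))
    (hst : ∀ ε > 0, ∃ δ > 0, ∀ x₁ : (Fin n → ℝ) × (Fin n → ℝ),
      dist x₁ (θe, fun _ => (∑ j, S.P j) / ∑ j, S.D j) < δ →
      ∀ X : ℝ → (Fin n → ℝ) × (Fin n → ℝ), X 0 = x₁ →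
        (∀ T : ℝ, ∀ t ∈ Icc 0 T, HasDerivWithinAt X (S.field (X t)) (Icc 0 T) t) →
        ∀ t, 0 ≤ t → dist (X t)
          ((fun j => θe j + (∑ j, S.P j) / (∑ j, S.D j) * t), fun _ => (∑ j, S.P j) / ∑ j, S.D j)
            < ε) :
    -(S.C u v * Real.cos (θe u - θe v)) * effectiveResistance cp u v ≤ 1 := by
  have hw : ∀ i j, S.C i j * Real.cos (θe i - θe j) = S.C j i * Real.cos (θe j - θe i) := by
    intro i j; rw [hC i j, ← Real.cos_neg, neg_sub]
  refine (SignedLaplacian.form_nonneg_iff hc hirr huv _).1 fun x => ?_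
  have h := S.hessForm_nonneg_of_stable_syncSolution hC hM hD he hst x
  rw [← SignedLaplacian.linForm_eq_half_sum_sq' _ hw x,
    SignedLaplacian.linForm_eq_posPart_add hw huv hcp x] at h
  exact h

/-- ★★ **Swing model, sufficiency**: `a · R⁺_eff(u ↔ v) < 1` makes the synchronous solution
Lyapunov-stable and attracting in the co-rotating frame.
[cite: ChenWangLiuBasarJohanssonQiu2016, §4 Corollary 2; ManikTimmeWitthaut2017, §3 Lemma 1 and Cor. 1] -/
theorem longLine_stable_syncSolution_of_lt_one (hC : ∀ i j, S.C i j = S.C j i) {u v : Fin n}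
    (huv : u ≠ v) (hM : ∀ i, 0 < S.M i) (hD : ∀ i, 0 < S.D i) {θe : Fin n → ℝ}
    (he : ∀ i, S.P i - S.D i * ((∑ j, S.P j) / ∑ j, S.D j) = S.flow θe i)
    {cp : Matrix (Fin n) (Fin n) ℝ}
    (hcp : ∀ i j, cp i j = if i = j then 0 else if (i = u ∧ j = v) ∨ (i = v ∧ j = u) then 0
      else S.C i j * Real.cos (θe i - θe j))
    (hc : IsConductance cp) (hirr : Literature.Probability.MarkovChains.IsIrreducible (networkKernel cp))
    (hlt : -(S.C u v * Real.cos (θe u - θe v)) * effectiveResistance cp u v < 1) {ε : ℝ}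
    (hε : 0 < ε) :
    ∃ δ > 0, ∀ x₁ : (Fin n → ℝ) × (Fin n → ℝ),
      dist x₁ (θe, fun _ => (∑ j, S.P j) / ∑ j, S.D j) < δ →
      (∃ X : ℝ → (Fin n → ℝ) × (Fin n → ℝ), X 0 = x₁ ∧
          ∀ T : ℝ, ∀ t ∈ Icc 0 T, HasDerivWithinAt X (S.field (X t)) (Icc 0 T) t) ∧
        ∀ X : ℝ → (Fin n → ℝ) × (Fin n → ℝ), X 0 = x₁ →
          (∀ T : ℝ, ∀ t ∈ Icc 0 T, HasDerivWithinAt X (S.field (X t)) (Icc 0 T) t) →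
          ∀ t, 0 ≤ t → dist ((fun j => (X t).1 j - (∑ j, S.P j) / (∑ j, S.D j) * t),
              (fun j => (X t).2 j - (∑ j, S.P j) / ∑ j, S.D j)) (θe, 0) < ε := by
  have hw : ∀ i j, S.C i j * Real.cos (θe i - θe j) = S.C j i * Real.cos (θe j - θe i) := by
    intro i j; rw [hC i j, ← Real.cos_neg, neg_sub]
  have hpos : ∀ x : Fin n → ℝ, (∃ i j, x i ≠ x j) →
      0 < 1 / 2 * ∑ i, ∑ j, S.C i j * Real.cos (θe i - θe j) * (x i - x j) ^ 2 := by
    intro x hx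
    rw [← SignedLaplacian.linForm_eq_half_sum_sq' _ hw x,
      SignedLaplacian.linForm_eq_posPart_add hw huv hcp x]
    refine ((SignedLaplacian.form_nonneg_iff hc hirr huv _).2 hlt.le x).lt_of_ne fun h0 => ?_
    obtain ⟨i, j, hij⟩ := hx
    exact hij (SignedLaplacian.const_of_form_eq_zero hc hirr huv hlt h0.symm i j)
  obtain ⟨δ, hδ, h⟩ := S.stable_syncSolution_of_hessForm_posDef hC hM hD he hpos hε
  exact ⟨δ, hδ, fun x₁ hx₁ => ⟨(h x₁ hx₁).1, fun X hX0 hX t ht => ((h x₁ hx₁).2 X hX0 hX).1 t ht⟩⟩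

/-- ★★★ **Swing model, beyond the threshold: a TYPE-1 saddle** — exactly one root of the swing
Jacobian at `(θ, 0)` in the open right half-plane, `(N − 2) + N` in the open left half-plane, one on
the axis. [cite: ChenWangLiuBasarJohanssonQiu2016, §4 Corollary 2; Chiang1995, §6.3 Theorem 6.1] -/
theorem longLine_typeOne_phaseJac_of_one_lt (hC : ∀ i j, S.C i j = S.C j i) {u v : Fin n}
    (huv : u ≠ v) (hM : ∀ i, 0 < S.M i) (hD : ∀ i, 0 < S.D i) (θ : Fin n → ℝ)
    {cp : Matrix (Fin n) (Fin n) ℝ}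
    (hcp : ∀ i j, cp i j = if i = j then 0 else if (i = u ∧ j = v) ∨ (i = v ∧ j = u) then 0
      else S.C i j * Real.cos (θ i - θ j))
    (hc : IsConductance cp) (hirr : Literature.Probability.MarkovChains.IsIrreducible (networkKernel cp))
    (hgt : 1 < -(S.C u v * Real.cos (θ u - θ v)) * effectiveResistance cp u v) :
    ((S.phaseJac θ).map (algebraMap ℝ ℂ)).charpoly.roots.countP (fun μ => 0 < μ.re) = 1
      ∧ ((S.phaseJac θ).map (algebraMap ℝ ℂ)).charpoly.roots.countP (fun μ => μ.re < 0)
        = n - 2 + n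
      ∧ ((S.phaseJac θ).map (algebraMap ℝ ℂ)).charpoly.roots.countP (fun μ => μ.re = 0) = 1 := by
  classical
  have hw : ∀ i j, S.C i j * Real.cos (θ i - θ j) = S.C j i * Real.cos (θ j - θ i) := by
    intro i j; rw [hC i j, ← Real.cos_neg, neg_sub]
  have hH : (S.hessMatrix θ).IsHermitian := S.hessMatrix_isHermitian hC θ
  have hrow : ∀ i, ∑ l, S.hessMatrix θ i l = 0 := fun i => sum_hessMatrix_row S θ i
  have hform : ∀ x : Fin n → ℝ, x ⬝ᵥ S.hessMatrix θ *ᵥ x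
      = 1 / 2 * ∑ i, ∑ j, cp i j * (x i - x j) ^ 2
        - (-(S.C u v * Real.cos (θ u - θ v))) * (x u - x v) ^ 2 := by
    intro x
    rw [S.hessMatrix_form]
    exact SignedLaplacian.linForm_eq_posPart_add hw huv hcp x
  obtain ⟨h1, h2, h3⟩ := SignedLaplacian.inertia_of_one_lt hc hirr huv hH hform hgt
  have hHm := refMinor_isHermitian hH u
  obtain ⟨r1, r2, -, hreg⟩ := RefNode.refMinor_counts hH hrow h2 u hHm
  obtain ⟨t1, t2, t3⟩ := S.countP_roots_charpoly_phaseJac_modRotation hM hD hC θ u hHm hreg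
  refine ⟨?_, ?_, t3⟩
  · rw [t1, r2, h1]
  · rw [t2, r1, h3, Fintype.card_fin]

end LosslessSystem

end ClassicalModel

end Literature.MathematicalPhysics.PowerSystems

end
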